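import Summits.HodgeConjecture.CorCM.GaloisTwentyFourDegenerateModels
import Mathlib.GroupTheory.SpecificGroups.Quaternion
import HarnessLib

/-!
# `Gal(K/ℚ) ≅ Q₈ × C₁₁` is BAD: a simple DEGENERATE CM abelian 44-fold (second arithmetic instance, `ord₁₁(2) = 10` even)

COR-CM (cell `pub-hodgecm2`), binder seat b04 (gen 24), count-neutral claim REAL-FACTOR — frontier instance (blanket
`CorCM/GaloisQuaternion*`, b04).  HC_CM is NOT proved here; an unconditional negative-side example.  KERNEL ONLY: theorems
(`decide` certificates); no definition, no named fact, no `sorry`.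

Companion of `CorCM/GaloisQuaternionCyclicFiveDegenerate` (see there for the two-sheet / `x² + y² = −1` analysis): for
`Gal(K/ℚ) ≅ Q₈ × C_p`, `c = (a², 1)`, a primitive degenerate type can exist only if `ord_p(2)` is even; `ord₁₁(2) = 10`.
Seat census (compute j187646, exhaustive over the `4¹¹` sheets): `443 536` degenerate two-sheet pairs at the character
`ψ ⊗ λ₁`, `≈ 99 %` of them primitive.  Certificate below: sheets `t = (1,3,1,0,0,0,0,0,0,0,0)`, `t' = (1,3,1,2,2,0,2,0,2,0,0)`,
balanced 20-element set from the annihilator lattice (`scratch-g24/g24f.py`), gen 20's format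
(`exists_simple_degenerate_of_model_balanced`).

References: Shimura (1998), §6.2 Thm. 3, §8.2 Prop. 26 [cite: Shimura1998]; Gordon (1999), Thm. 6.4, §9.3
[cite: Gordon1999HodgeAVSurvey]; Dodson (1984), §3.1.1, §5.3 [cite: Dodson1984].
-/

noncomputable section

open CategoryTheory CategoryTheory.Limits NumberField
open scoped BigOperators

namespace Summit.HodgeConjecture.CorCM.GaloisModels

open Literature.NumberTheory.ComplexMultiplication
open Literature.AlgebraicGeometry.Motives (AbelianVariety CMType)
open Literature.AlgebraicGeometry.HodgeTheory
open Literature.AlgebraicGeometry.ComplexMultiplication (IsCMTypeRealisation)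
open Literature.AlgebraicGeometry.Pohlmann1968
open Literature.Barriers.HodgeConjecture (divisorClassesSpan)
open QuaternionGroup

variable {K : Type} [Field K] [NumberField K] [IsCMField K] [IsGalois ℚ K]

set_option maxRecDepth 8000 in
/-- The central elements of order `≤ 2` of `Q₈ × C₁₁` are `1` and `(a², 1)`. [folklore] -/
theorem central_involution_quaternion_cyclicEleven :
    ∀ x : QuaternionGroup 2 × Multiplicative (ZMod 11), x * x = 1 → (∀ y, x * y = y * x) →
      x = 1 ∨ x = (a 2, Multiplicative.ofAdd 0) := by
  decide

set_option maxRecDepth 8000 in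
/-- **`Gal(K/ℚ) ≅ Q₈ × C₁₁` with complex conjugation `(a², 1)` — `K` = (`Q₈`-CM field) · (real cyclic field of degree
`11`): a simple DEGENERATE abelian `44`-fold with CM by `K`** (two-sheet type over `C₁₁`, balanced set of `20` elements moved
by `c`), with a rational `(p,p)` class outside the divisor ring on some power. [cite: Shimura1998, §6.2 Thm. 3 and §8.2 Prop. 26]
[cite: Gordon1999HodgeAVSurvey, Thm. 6.4] -/
theorem exists_simple_degenerate_of_quaternion_cyclicEleven
    (e : (K ≃ₐ[ℚ] K) ≃* QuaternionGroup 2 × Multiplicative (ZMod 11))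
    (hc : e ((IsCMField.complexConj K).restrictScalars ℚ) = (a 2, Multiplicative.ofAdd 0)) :
    ∃ (Φ : CMType K) (φ₀ : K →+* ℂ) (A : AbelianVariety ℂ) (ι : 𝓞 K →+* End A)
      (θ : K →+* Module.End ℂ (complexBetti A.X 1)),
      IsPrimitive (ℂ ≃+* ℂ) Φ.1 φ₀ ∧ ¬ IsNondegenerate Φ ∧ IsCMTypeRealisation Φ A ι θ ∧ A.IsSimple ∧
      A.dim = 44 ∧
      ∃ n p : ℕ, ∃ x : complexBetti (⨁ fun _ : Fin n => A).X (2 * p), IsRationalClass x ∧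
        IsOfHodgeType (⨁ fun _ : Fin n => A).dim (⨁ fun _ : Fin n => A).X (2 * p) p p x ∧
        x ∉ divisorClassesSpan (⨁ fun _ : Fin n => A).X (⨁ fun _ : Fin n => A).dim p := by
  have h := exists_simple_degenerate_of_model_balanced e _ hc
    {(a 0, Multiplicative.ofAdd 1), (a 0, Multiplicative.ofAdd 3), (a 0, Multiplicative.ofAdd 4),
      (a 0, Multiplicative.ofAdd 5), (a 0, Multiplicative.ofAdd 6), (a 0, Multiplicative.ofAdd 7),
      (a 0, Multiplicative.ofAdd 8), (a 0, Multiplicative.ofAdd 9), (a 0, Multiplicative.ofAdd 10),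
      (a 1, Multiplicative.ofAdd 0), (a 1, Multiplicative.ofAdd 2), (a 1, Multiplicative.ofAdd 3),
      (a 1, Multiplicative.ofAdd 4), (a 1, Multiplicative.ofAdd 5), (a 1, Multiplicative.ofAdd 6),
      (a 1, Multiplicative.ofAdd 7), (a 1, Multiplicative.ofAdd 8), (a 1, Multiplicative.ofAdd 9),
      (a 1, Multiplicative.ofAdd 10), (a 2, Multiplicative.ofAdd 0), (a 2, Multiplicative.ofAdd 2),
      (a 3, Multiplicative.ofAdd 1), (xa 0, Multiplicative.ofAdd 1), (xa 0, Multiplicative.ofAdd 5),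
      (xa 0, Multiplicative.ofAdd 7), (xa 0, Multiplicative.ofAdd 9), (xa 0, Multiplicative.ofAdd 10),
      (xa 1, Multiplicative.ofAdd 0), (xa 1, Multiplicative.ofAdd 2), (xa 1, Multiplicative.ofAdd 5),
      (xa 1, Multiplicative.ofAdd 7), (xa 1, Multiplicative.ofAdd 9), (xa 1, Multiplicative.ofAdd 10),
      (xa 2, Multiplicative.ofAdd 0), (xa 2, Multiplicative.ofAdd 2), (xa 2, Multiplicative.ofAdd 3),
      (xa 2, Multiplicative.ofAdd 4), (xa 2, Multiplicative.ofAdd 6), (xa 2, Multiplicative.ofAdd 8),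
      (xa 3, Multiplicative.ofAdd 1), (xa 3, Multiplicative.ofAdd 3), (xa 3, Multiplicative.ofAdd 4),
      (xa 3, Multiplicative.ofAdd 6), (xa 3, Multiplicative.ofAdd 8)}
    (by decide) (by decide)
    {(a 0, Multiplicative.ofAdd 0), (a 0, Multiplicative.ofAdd 6), (a 0, Multiplicative.ofAdd 7),
      (a 1, Multiplicative.ofAdd 4), (a 1, Multiplicative.ofAdd 10), (a 2, Multiplicative.ofAdd 3),
      (a 2, Multiplicative.ofAdd 4), (a 2, Multiplicative.ofAdd 5), (a 3, Multiplicative.ofAdd 3),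
      (a 3, Multiplicative.ofAdd 7), (xa 0, Multiplicative.ofAdd 5), (xa 0, Multiplicative.ofAdd 6),
      (xa 0, Multiplicative.ofAdd 10), (xa 1, Multiplicative.ofAdd 2), (xa 1, Multiplicative.ofAdd 9),
      (xa 2, Multiplicative.ofAdd 1), (xa 2, Multiplicative.ofAdd 2), (xa 2, Multiplicative.ofAdd 9),
      (xa 3, Multiplicative.ofAdd 0), (xa 3, Multiplicative.ofAdd 1)}
    (by decide) (by decide)
  rwa [Fintype.card_prod, QuaternionGroup.card, Fintype.card_multiplicative, ZMod.card] at h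

/-- **`Gal(K/ℚ) ≅ Q₈ × C₁₁` is BAD for the (unique) complex conjugation.** [cite: Shimura1998, §6.2 Thm. 3 and §8.2 Prop. 26]
[cite: Gordon1999HodgeAVSurvey, Thm. 6.4] -/
theorem exists_simple_degenerate_of_mulEquiv_quaternion_cyclicEleven
    (e : (K ≃ₐ[ℚ] K) ≃* QuaternionGroup 2 × Multiplicative (ZMod 11)) :
    ∃ (Φ : CMType K) (φ₀ : K →+* ℂ) (A : AbelianVariety ℂ) (ι : 𝓞 K →+* End A)
      (θ : K →+* Module.End ℂ (complexBetti A.X 1)),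
      IsPrimitive (ℂ ≃+* ℂ) Φ.1 φ₀ ∧ ¬ IsNondegenerate Φ ∧ IsCMTypeRealisation Φ A ι θ ∧ A.IsSimple ∧
      A.dim = 44 ∧
      ∃ n p : ℕ, ∃ x : complexBetti (⨁ fun _ : Fin n => A).X (2 * p), IsRationalClass x ∧
        IsOfHodgeType (⨁ fun _ : Fin n => A).dim (⨁ fun _ : Fin n => A).X (2 * p) p p x ∧
        x ∉ divisorClassesSpan (⨁ fun _ : Fin n => A).X (⨁ fun _ : Fin n => A).dim p := by
  set c₀ := e ((IsCMField.complexConj K).restrictScalars ℚ) with hc₀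
  have hcc : c₀ * c₀ = 1 := GaloisRank.model_complexConj_mul_self e rfl
  have hz : ∀ y, c₀ * y = y * c₀ := fun y => GaloisRank.model_complexConj_comm e rfl y
  have hne : c₀ ≠ 1 := GaloisRank.model_complexConj_ne_one e rfl
  rcases central_involution_quaternion_cyclicEleven c₀ hcc hz with h | h
  · exact absurd h hne
  · exact exists_simple_degenerate_of_quaternion_cyclicEleven e h

end Summit.HodgeConjecture.CorCM.GaloisModels

end
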